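/-
Copyright (c) 2026. All rights reserved.
Released under Apache 2.0 license as described in the file LICENSE.
-/
import Literature.AlgebraicGeometry.Pohlmann1968.AbelianCMFieldSurvivorClosureCriterion
import Literature.NumberTheory.ComplexMultiplication.DegenerateCMTypesAbelianSurvivorTernaryClosure
import HarnessLib

/-!
# Abelian CM fields: `B = D` on `A` iff Kubota's survivors are closed under triple products; an exceptional Hodge
# class on `A` iff three survivors have a product annihilated by the type

SETTING.  `K` an ABELIAN CM field, `G = Gal(K/ℚ)`, `ρ = conjGal`, `φ₀ : K → ℂ` a base embedding, `Φ` a CM type of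
`K` read on `G` as `T = {g : σ_g ∈ Φ}` (tree `embOf`), `Ŝ(χ) = Σ_{t ∈ T} χ(t)` for a character `χ` of `G`, the
SURVIVORS `S(Φ) = {χ : χ(ρ) = −1, Ŝ(χ) ≠ 0}` (`Rank(Φ) = 1 + #S(Φ)`, T. Kubota [Kubota1965] §4 Lemma 2 = B. B.
Gordon [Gordon1999HodgeAVSurvey] Prop. 9.4.1).  The tree decides `Bᵐ(A) ⊗ ℂ = Dᵐ(A) ⊗ ℂ ∀ m` for an abelian
variety `A` of type `(K; Φ)` by «every odd character of the group `⟨S(Φ)⟩` survives» (g40-#2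
`forall_hodgeClassSpan_eq_iff_forall_mem_closure`) and knows, at the group level, that this is the FINITE condition
«`S(Φ)` is closed under triple products» (g40-#5 `AbelianStabilizer.two_mul_card_stabilizer_mul_eq_iff_forall_add_add`;
the survivors are closed under conjugation, so the odd elements of `⟨S⟩` are the odd-length sums of survivors).
THIS FILE is the field-side reading:

> **Theorem** (`forall_hodgeClassSpan_eq_iff_forall_add_add`).  `K` abelian CM, `Φ` ANY CM type, `A` ANY abelian
> variety of type `(K; Φ)`: **`Bᵐ(A) ⊗ ℂ = Dᵐ(A) ⊗ ℂ` for all `m` iff `Σ_{t ∈ T} (χ₁χ₂χ₃)(t) ≠ 0` for all odd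
> characters `χ₁, χ₂, χ₃` of `Gal(K/ℚ)` with `Σ_{t ∈ T} χᵢ(t) ≠ 0`** — and then the Hodge conjecture holds for every
> power `Aⁿ` (`hodgeConjectureFor_pow_of_forall_add_add`).
> **Theorem** (`exists_exceptional_iff_exists_add_add`).  **`A` carries an exceptional Hodge class iff there are
> three survivors `χ₁, χ₂, χ₃` with `Σ_{t ∈ T} (χ₁χ₂χ₃)(t) = 0`.**

For a PRIMITIVE type (`⟨S⟩ = Ĝ`, `A` simple) this is Kubota–Pohlmann–White («sporadic cycle iff an odd character is
annihilated», [Pohlmann1968] Thm. 1, [White1993SporadicCycles] §4 Thm. 3) in a sharpened form: it suffices to test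
the products of three survivors.

* §1 `two_mul_card_stabilizer_mul_eq_iff_two_mul_natCard_twistStabilizer_mul_eq` (the group-level and field-level
  extremal conditions agree, realisation-free), **`forall_hodgeClassSpan_eq_iff_forall_add_add`**,
  **`hodgeClassSpan_pow_eq_divisorClassesSpan_of_forall_add_add`**, **`hodgeConjectureFor_pow_of_forall_add_add`**,
  **`exists_exceptional_iff_exists_add_add`**, `not_exists_exceptional_iff_forall_add_add`.

HONEST SCOPE.  Dictionary + assembly (g39-#7, g39-#9, g39-#11, g40-#2, g40-#5); abelian `K` only.  The sources print
Kubota's formula and the primitive criterion; the ternary form is this file's packaging, not a numbered statement of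
the sources.  THEOREMS ONLY: no definition, no named fact, no instance, no `sorry`.

## References

* [Kubota1965] T. Kubota, *On the field extension by complex multiplication*, Trans. AMS 118 (1965), §2, §4 Lemma 2.
* [Pohlmann1968] H. Pohlmann, *Algebraic cycles on abelian varieties of complex multiplication type*, Ann. of Math. 88
  (1968), Thm. 1, §3.
* [White1993SporadicCycles] S. P. White, *Sporadic cycles on CM abelian varieties*, Compositio Math. 88 (1993), §4 Thm. 3.
* [Gordon1999HodgeAVSurvey] B. B. Gordon, *A survey of the Hodge conjecture for abelian varieties*, Thm. 6.4, §9.2–9.3,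
  Prop. 9.4.1.
* [Shimura1998] G. Shimura, *Abelian Varieties with Complex Multiplication and Modular Functions*, §8.4 Example (1),
  §18.2 Lemma (i), §32.10.

## Provenance

Lane `lit-hodgefound` (Track 2, Layer A5), seat `lit-hodgefound-p10` generation 40, row g40-#6; neighbours cited by
name, nothing restated: `DegenerateCMTypesAbelianSurvivorTernaryClosure` (g40-#5:
`two_mul_card_stabilizer_mul_eq_iff_forall_add_add`),
`AbelianCMFieldStabilizerCharacterCriterion` (g39-#11: `natCard_twistStabilizer_eq_card_stabilizer`,
`two_mul_card_stabilizer_mul_eq_iff_forall_hodgeClassSpan_eq`), `AbelianCMFieldStabilizerExceptionalClasses` (g39-#9: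
`two_mul_natCard_twistStabilizer_mul_lt_iff_exists_exceptional`, `two_mul_natCard_twistStabilizer_mul_eq_iff_forall_hodgeClassSpan_eq`), `CMTypeRankStabilizerBound` (g39-#7:
`hodgeClassSpan_pow_eq_divisorClassesSpan_of_two_mul_natCard_twistStabilizer_mul_eq`,
`hodgeConjectureFor_pow_of_two_mul_natCard_twistStabilizer_mul_eq`, `two_mul_natCard_twistStabilizer_mul_cmTypeRank_sub_one_le`),
`CMTypeRankCharactersNumberField` (`embOf`, `cmTypeRank_eq_typeRank_gal`, `isCMTypeWith_gal`).
-/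

open scoped BigOperators NumberField IsMulCommutative Classical
open NumberField Module CategoryTheory CategoryTheory.Limits IntermediateField

namespace Literature.AlgebraicGeometry.Pohlmann1968

open scoped Literature.NumberTheory.ComplexMultiplication
open Literature.NumberTheory.ComplexMultiplication (twistStabilizer typeRank IsCMTypeWith conjGal conjGal_apply)
open Literature.NumberTheory.ComplexMultiplication.CyclicCMType.AbelianStabilizer
  (two_mul_card_stabilizer_mul_eq_iff_forall_add_add)
open Literature.AlgebraicGeometry.Motives (CMType AbelianVariety)
open Literature.AlgebraicGeometry.HodgeTheory
open Literature.AlgebraicGeometry.VanGeemen1994 (hodgeClassSpan)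
open Literature.Barriers.HodgeConjecture (divisorClassesSpan)
open Literature.AlgebraicGeometry.ComplexMultiplication (IsCMTypeRealisation)

variable {K : Type} [Field K] [NumberField K] [IsCMField K]
  {A : AbelianVariety ℂ} {ι : 𝓞 K →+* End A} {θ : K →+* Module.End ℂ (complexBetti A.X 1)}

/-! ## §0 The type read on the Galois group is a CM type for `ρ = conjGal` -/

section Helpers

/-- `σ_{ρg} = σ̄_g`: `conjGal` acts as complex conjugation under any embedding. [cite: Shimura1998, §18.2 Lemma (i)] -/
private theorem apply_conjGal_eq_cc_tc (φ₀ : K →+* ℂ) (x : K) :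
    φ₀ ((conjGal : K ≃ₐ[ℚ] K) x) = starRingEnd ℂ (φ₀ x) := by
  rw [conjGal_apply, IsCMField.complexEmbedding_complexConj]

variable [IsAbelianGalois ℚ K]

/-- `T = {g : σ_g ∈ Φ}` is a CM type on `G = Gal(K/ℚ)` w.r.t. `ρ = conjGal` (abelian `K`).
[cite: Kubota1965, §4 Lemma 2] [cite: Shimura1998, §18.2 Lemma (i)] -/
private theorem isCMTypeWith_filter_tc (Φ : CMType K) (φ₀ : K →+* ℂ) :
    IsCMTypeWith (conjGal : K ≃ₐ[ℚ] K)
      (↑(Finset.univ.filter fun s : K ≃ₐ[ℚ] K => embOf φ₀ s ∈ Φ.1) : Set (K ≃ₐ[ℚ] K)) := by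
  rw [Finset.coe_filter_univ]
  exact isCMTypeWith_gal (fun g h => mul_comm g h) Φ φ₀ conjGal (apply_conjGal_eq_cc_tc φ₀)

end Helpers

variable [IsAbelianGalois ℚ K]

/-! ## §1 The ternary criterion on the field side -/

section Ternary

omit [IsCMField K] in
/-- **The group-level and the field-level extremal conditions agree** (realisation-free):
`2·|Stab(T)|·(rank(T) − 1) = |G| ⟺ 2·|Stab(Φ)|·(Rank(Φ) − 1) = [K:ℚ]` (`|Stab(Φ)| = |Stab(T)|`, `Rank(Φ) = rank(T)`,
`|G| = [K:ℚ]`). [cite: Kubota1965, §4 Lemma 2] [cite: Shimura1998, §8.4 Example (1) and §32.10] -/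
theorem two_mul_card_stabilizer_mul_eq_iff_two_mul_natCard_twistStabilizer_mul_eq [IsCMField K] (Φ : CMType K)
    (φ₀ : K →+* ℂ) :
    2 * (Finset.univ.filter fun g : K ≃ₐ[ℚ] K => ∀ t : K ≃ₐ[ℚ] K,
          t * g ∈ (Finset.univ.filter fun s : K ≃ₐ[ℚ] K => embOf φ₀ s ∈ Φ.1) ↔
            t ∈ (Finset.univ.filter fun s : K ≃ₐ[ℚ] K => embOf φ₀ s ∈ Φ.1)).card *
        (typeRank (K ≃ₐ[ℚ] K)
          (↑(Finset.univ.filter fun s : K ≃ₐ[ℚ] K => embOf φ₀ s ∈ Φ.1) : Set (K ≃ₐ[ℚ] K)) - 1) =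
        Fintype.card (K ≃ₐ[ℚ] K) ↔
      2 * Nat.card (twistStabilizer Φ) * (cmTypeRank Φ - 1) = finrank ℚ K := by
  rw [natCard_twistStabilizer_eq_card_stabilizer φ₀ Φ, Finset.coe_filter_univ,
    ← cmTypeRank_eq_typeRank_gal (fun g h => mul_comm g h) Φ φ₀, ← Nat.card_eq_fintype_card,
    IsGalois.card_aut_eq_finrank]

/-- **`Bᵐ(A) ⊗ ℂ = Dᵐ(A) ⊗ ℂ` FOR ALL `m` IFF THE SURVIVORS ARE CLOSED UNDER TRIPLE PRODUCTS** (abelian CM field `K`,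
any CM type `Φ`, any abelian variety `A` of type `(K; Φ)`): for all characters `χ₁, χ₂, χ₃` of `Gal(K/ℚ)` with
`χᵢ(ρ) = −1` and `Σ_{t ∈ T} χᵢ(t) ≠ 0`, also `Σ_{t ∈ T} (χ₁χ₂χ₃)(t) ≠ 0`. [cite: Kubota1965, §2 and §4 Lemma 2]
[cite: Pohlmann1968, Thm. 1] [cite: White1993SporadicCycles, §4 Theorem 3] [cite: Gordon1999HodgeAVSurvey, Thm. 6.4 and Prop. 9.4.1] -/
theorem forall_hodgeClassSpan_eq_iff_forall_add_add (Φ : CMType K) (φ₀ : K →+* ℂ)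
    (hA : IsCMTypeRealisation Φ A ι θ) :
    (∀ m : ℕ, hodgeClassSpan (finrank ℚ K / 2) A.X m = divisorClassesSpan A.X (finrank ℚ K / 2) m) ↔
      ∀ χ₁ χ₂ χ₃ : AddChar (Additive (K ≃ₐ[ℚ] K)) ℂ,
        χ₁ (Additive.ofMul (conjGal : K ≃ₐ[ℚ] K)) = -1 →
          ∑ s ∈ (Finset.univ.filter fun s : K ≃ₐ[ℚ] K => embOf φ₀ s ∈ Φ.1), χ₁ (Additive.ofMul s) ≠ 0 →
        χ₂ (Additive.ofMul (conjGal : K ≃ₐ[ℚ] K)) = -1 →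
          ∑ s ∈ (Finset.univ.filter fun s : K ≃ₐ[ℚ] K => embOf φ₀ s ∈ Φ.1), χ₂ (Additive.ofMul s) ≠ 0 →
        χ₃ (Additive.ofMul (conjGal : K ≃ₐ[ℚ] K)) = -1 →
          ∑ s ∈ (Finset.univ.filter fun s : K ≃ₐ[ℚ] K => embOf φ₀ s ∈ Φ.1), χ₃ (Additive.ofMul s) ≠ 0 →
          ∑ s ∈ (Finset.univ.filter fun s : K ≃ₐ[ℚ] K => embOf φ₀ s ∈ Φ.1),
            (χ₁ + χ₂ + χ₃) (Additive.ofMul s) ≠ 0 := by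
  rw [← two_mul_card_stabilizer_mul_eq_iff_forall_hodgeClassSpan_eq Φ φ₀ hA]
  exact two_mul_card_stabilizer_mul_eq_iff_forall_add_add (isCMTypeWith_filter_tc Φ φ₀)

/-- **Ternary-closed survivors ⟹ `Bᵐ(Aⁿ) ⊗ ℂ = Dᵐ(Aⁿ) ⊗ ℂ` for all `n, m`.** [cite: Gordon1999HodgeAVSurvey, Thm. 6.4 and §9.3]
[cite: Kubota1965, §4 Lemma 2] [cite: Shimura1998, §32.9–32.10] -/
theorem hodgeClassSpan_pow_eq_divisorClassesSpan_of_forall_add_add (Φ : CMType K) (φ₀ : K →+* ℂ)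
    (h3 : ∀ χ₁ χ₂ χ₃ : AddChar (Additive (K ≃ₐ[ℚ] K)) ℂ,
        χ₁ (Additive.ofMul (conjGal : K ≃ₐ[ℚ] K)) = -1 →
          ∑ s ∈ (Finset.univ.filter fun s : K ≃ₐ[ℚ] K => embOf φ₀ s ∈ Φ.1), χ₁ (Additive.ofMul s) ≠ 0 →
        χ₂ (Additive.ofMul (conjGal : K ≃ₐ[ℚ] K)) = -1 →
          ∑ s ∈ (Finset.univ.filter fun s : K ≃ₐ[ℚ] K => embOf φ₀ s ∈ Φ.1), χ₂ (Additive.ofMul s) ≠ 0 →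
        χ₃ (Additive.ofMul (conjGal : K ≃ₐ[ℚ] K)) = -1 →
          ∑ s ∈ (Finset.univ.filter fun s : K ≃ₐ[ℚ] K => embOf φ₀ s ∈ Φ.1), χ₃ (Additive.ofMul s) ≠ 0 →
          ∑ s ∈ (Finset.univ.filter fun s : K ≃ₐ[ℚ] K => embOf φ₀ s ∈ Φ.1),
            (χ₁ + χ₂ + χ₃) (Additive.ofMul s) ≠ 0)
    (hA : IsCMTypeRealisation Φ A ι θ) (n m : ℕ) :
    hodgeClassSpan (⨁ fun _ : Fin n => A).dim (⨁ fun _ : Fin n => A).X m =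
      divisorClassesSpan (⨁ fun _ : Fin n => A).X (⨁ fun _ : Fin n => A).dim m :=
  hodgeClassSpan_pow_eq_divisorClassesSpan_of_two_mul_natCard_twistStabilizer_mul_eq Φ
    ((two_mul_card_stabilizer_mul_eq_iff_two_mul_natCard_twistStabilizer_mul_eq Φ φ₀).1
      ((two_mul_card_stabilizer_mul_eq_iff_forall_add_add (isCMTypeWith_filter_tc Φ φ₀)).2 h3)) hA n m

/-- **TERNARY-CLOSED SURVIVORS ⟹ THE HODGE CONJECTURE FOR EVERY POWER `Aⁿ`** (abelian CM field, any type, any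
realisation). [cite: Gordon1999HodgeAVSurvey, Thm. 6.4 and §9.3] [cite: Kubota1965, §4 Lemma 2] [cite: Shimura1998, §32.9–32.10] -/
theorem hodgeConjectureFor_pow_of_forall_add_add (Φ : CMType K) (φ₀ : K →+* ℂ)
    (h3 : ∀ χ₁ χ₂ χ₃ : AddChar (Additive (K ≃ₐ[ℚ] K)) ℂ,
        χ₁ (Additive.ofMul (conjGal : K ≃ₐ[ℚ] K)) = -1 →
          ∑ s ∈ (Finset.univ.filter fun s : K ≃ₐ[ℚ] K => embOf φ₀ s ∈ Φ.1), χ₁ (Additive.ofMul s) ≠ 0 →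
        χ₂ (Additive.ofMul (conjGal : K ≃ₐ[ℚ] K)) = -1 →
          ∑ s ∈ (Finset.univ.filter fun s : K ≃ₐ[ℚ] K => embOf φ₀ s ∈ Φ.1), χ₂ (Additive.ofMul s) ≠ 0 →
        χ₃ (Additive.ofMul (conjGal : K ≃ₐ[ℚ] K)) = -1 →
          ∑ s ∈ (Finset.univ.filter fun s : K ≃ₐ[ℚ] K => embOf φ₀ s ∈ Φ.1), χ₃ (Additive.ofMul s) ≠ 0 →
          ∑ s ∈ (Finset.univ.filter fun s : K ≃ₐ[ℚ] K => embOf φ₀ s ∈ Φ.1),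
            (χ₁ + χ₂ + χ₃) (Additive.ofMul s) ≠ 0)
    (hA : IsCMTypeRealisation Φ A ι θ) (n : ℕ) :
    HodgeConjectureFor (⨁ fun _ : Fin n => A).dim (⨁ fun _ : Fin n => A).X :=
  hodgeConjectureFor_pow_of_two_mul_natCard_twistStabilizer_mul_eq Φ
    ((two_mul_card_stabilizer_mul_eq_iff_two_mul_natCard_twistStabilizer_mul_eq Φ φ₀).1
      ((two_mul_card_stabilizer_mul_eq_iff_forall_add_add (isCMTypeWith_filter_tc Φ φ₀)).2 h3)) hA n

/-- **`A` CARRIES AN EXCEPTIONAL HODGE CLASS IFF THREE SURVIVORS HAVE A PRODUCT ANNIHILATED BY THE TYPE**: odd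
characters `χ₁, χ₂, χ₃` of `Gal(K/ℚ)` with `Σ_{t ∈ T} χᵢ(t) ≠ 0` and `Σ_{t ∈ T} (χ₁χ₂χ₃)(t) = 0` (abelian CM field,
any CM type, any abelian variety of the type). [cite: Kubota1965, §2 and §4 Lemma 2] [cite: Pohlmann1968, Thm. 1 and §3]
[cite: White1993SporadicCycles, §4 Theorem 3] [cite: Gordon1999HodgeAVSurvey, Thm. 6.4 and §9.2] -/
theorem exists_exceptional_iff_exists_add_add (Φ : CMType K) (φ₀ : K →+* ℂ) (hA : IsCMTypeRealisation Φ A ι θ) :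
    (∃ m : ℕ, ∃ c : complexBetti A.X (2 * m), IsRationalClass c ∧
        IsOfHodgeType (finrank ℚ K / 2) A.X (2 * m) m m c ∧ c ∉ divisorClassesSpan A.X (finrank ℚ K / 2) m) ↔
      ∃ χ₁ χ₂ χ₃ : AddChar (Additive (K ≃ₐ[ℚ] K)) ℂ,
        χ₁ (Additive.ofMul (conjGal : K ≃ₐ[ℚ] K)) = -1 ∧
          ∑ s ∈ (Finset.univ.filter fun s : K ≃ₐ[ℚ] K => embOf φ₀ s ∈ Φ.1), χ₁ (Additive.ofMul s) ≠ 0 ∧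
        χ₂ (Additive.ofMul (conjGal : K ≃ₐ[ℚ] K)) = -1 ∧
          ∑ s ∈ (Finset.univ.filter fun s : K ≃ₐ[ℚ] K => embOf φ₀ s ∈ Φ.1), χ₂ (Additive.ofMul s) ≠ 0 ∧
        χ₃ (Additive.ofMul (conjGal : K ≃ₐ[ℚ] K)) = -1 ∧
          ∑ s ∈ (Finset.univ.filter fun s : K ≃ₐ[ℚ] K => embOf φ₀ s ∈ Φ.1), χ₃ (Additive.ofMul s) ≠ 0 ∧
          ∑ s ∈ (Finset.univ.filter fun s : K ≃ₐ[ℚ] K => embOf φ₀ s ∈ Φ.1),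
            (χ₁ + χ₂ + χ₃) (Additive.ofMul s) = 0 := by
  rw [← two_mul_natCard_twistStabilizer_mul_lt_iff_exists_exceptional Φ hA,
    (two_mul_natCard_twistStabilizer_mul_cmTypeRank_sub_one_le Φ).lt_iff_ne, Ne,
    two_mul_natCard_twistStabilizer_mul_eq_iff_forall_hodgeClassSpan_eq Φ hA,
    forall_hodgeClassSpan_eq_iff_forall_add_add Φ φ₀ hA]
  constructor
  · intro H
    by_contra hno
    exact H fun χ₁ χ₂ χ₃ h₁ hS₁ h₂ hS₂ h₃ hS₃ h0 => hno ⟨χ₁, χ₂, χ₃, h₁, hS₁, h₂, hS₂, h₃, hS₃, h0⟩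
  · rintro ⟨χ₁, χ₂, χ₃, h₁, hS₁, h₂, hS₂, h₃, hS₃, h0⟩ H
    exact H χ₁ χ₂ χ₃ h₁ hS₁ h₂ hS₂ h₃ hS₃ h0

/-- **No exceptional Hodge class on `A` iff the survivors are ternary-closed.** [cite: Kubota1965, §2 and §4 Lemma 2]
[cite: White1993SporadicCycles, §4 Theorem 3] [cite: Gordon1999HodgeAVSurvey, Thm. 6.4] -/
theorem not_exists_exceptional_iff_forall_add_add (Φ : CMType K) (φ₀ : K →+* ℂ)
    (hA : IsCMTypeRealisation Φ A ι θ) :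
    (¬ ∃ m : ℕ, ∃ c : complexBetti A.X (2 * m), IsRationalClass c ∧
        IsOfHodgeType (finrank ℚ K / 2) A.X (2 * m) m m c ∧ c ∉ divisorClassesSpan A.X (finrank ℚ K / 2) m) ↔
      ∀ χ₁ χ₂ χ₃ : AddChar (Additive (K ≃ₐ[ℚ] K)) ℂ,
        χ₁ (Additive.ofMul (conjGal : K ≃ₐ[ℚ] K)) = -1 →
          ∑ s ∈ (Finset.univ.filter fun s : K ≃ₐ[ℚ] K => embOf φ₀ s ∈ Φ.1), χ₁ (Additive.ofMul s) ≠ 0 →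
        χ₂ (Additive.ofMul (conjGal : K ≃ₐ[ℚ] K)) = -1 →
          ∑ s ∈ (Finset.univ.filter fun s : K ≃ₐ[ℚ] K => embOf φ₀ s ∈ Φ.1), χ₂ (Additive.ofMul s) ≠ 0 →
        χ₃ (Additive.ofMul (conjGal : K ≃ₐ[ℚ] K)) = -1 →
          ∑ s ∈ (Finset.univ.filter fun s : K ≃ₐ[ℚ] K => embOf φ₀ s ∈ Φ.1), χ₃ (Additive.ofMul s) ≠ 0 →
          ∑ s ∈ (Finset.univ.filter fun s : K ≃ₐ[ℚ] K => embOf φ₀ s ∈ Φ.1),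
            (χ₁ + χ₂ + χ₃) (Additive.ofMul s) ≠ 0 := by
  rw [exists_exceptional_iff_exists_add_add Φ φ₀ hA]
  constructor
  · intro H χ₁ χ₂ χ₃ h₁ hS₁ h₂ hS₂ h₃ hS₃ h0
    exact H ⟨χ₁, χ₂, χ₃, h₁, hS₁, h₂, hS₂, h₃, hS₃, h0⟩
  · rintro H ⟨χ₁, χ₂, χ₃, h₁, hS₁, h₂, hS₂, h₃, hS₃, h0⟩
    exact H χ₁ χ₂ χ₃ h₁ hS₁ h₂ hS₂ h₃ hS₃ h0

end Ternary

end Literature.AlgebraicGeometry.Pohlmann1968
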